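import Summits.CriticalPhenomena.PercolationContinuityZ3.Theorems.PercNearOneGluingNoHeavyLowerTailKnQuestion8CoefficientwiseDominationPairing
import HarnessLib

/-!
# A uniform dominating injection proves NC* for every target set at once — prim-lf-2 gen 65

Support file (`--supports stmt-CriticalPhenomena-4575`, closed), prover `prim-lf-2` (gen 65).  No definitions, no named facts, no sorries; standard axioms.
Memo `prim-lf-2/CW-NCDOWN-gen65.md` §4.4 (CONJECTURE DM2, uniform form); the pairing principle is `tsum_nonneg_of_dominating_injection`.

If `t` dominates `s` (`K_s ∪ B_s ⊆ K_t`, `B_t ⊆ K_s ∩ B_s`, or the mirror image) then the core of `t` is contained in the core of `s`: `K_t ∩ B_t ⊆ K_s ∩ B_s`.  Hence ONE injective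
dominating map on all colourings with incomparable clusters (no event) stays inside every event that is antitone in the core — in particular inside every NC* event
`{Z ∩ W = ∅}` — and proves all these sums at once.  CONJECTURE DM2 (prim-lf-2 gen 65; dommat.c: true for every 2-connected graph rooted at a degree-two vertex with
≤ 7 vertices, n = 8 running): such a uniform map exists at degree-two roots of 2-connected graphs; by this file it would give NC* there for every `W`.
* `Coefficientwise.coreAntitone_tsum_nonneg_of_uniform_domination` — for every predicate `D` antitone on the core.
* `Coefficientwise.ncStar_of_uniform_domination` — the NC* shape, every `W`.
[cite: KozmaNitzan2024, Questions 8–9 (§5.5 p. 36) (context: the Question-8 pocket covariance programme)]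
-/

namespace Summit.CriticalPhenomena.PercolationContinuityZ3.Theorems

open Finset Literature.Probability.Percolation

namespace Coefficientwise

variable {ι V : Type*} [DecidableEq ι]

open Classical in
/-- **Uniform domination ⇒ every core-antitone event.**  If `φ` sends every `s ⊆ E` with `⊆`-incomparable clusters to a subset of `E` dominating it, injectively, then for
every predicate `D` on vertex sets with `D Z → Z' ⊆ Z → D Z'` and all monotone `f, g`: `0 ≤ Σ_{s ⊆ E : D (C_x s ∩ C_x(E∖s))} (f (C_x s) − f (C_x(E∖s)))(g (C_x s) − g (C_x(E∖s)))`.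
[cite: KozmaNitzan2024, Questions 8–9 (§5.5 p. 36) (context)] -/
theorem coreAntitone_tsum_nonneg_of_uniform_domination (ends : ι → Sym2 V) (E : Finset ι) (x : V) (φ : Finset ι → Finset ι)
    (hdom : ∀ s, s ⊆ E → ¬ (openCluster (ends '' (↑s : Set ι)) x ⊆ openCluster (ends '' (↑(E \ s) : Set ι)) x) →
      ¬ (openCluster (ends '' (↑(E \ s) : Set ι)) x ⊆ openCluster (ends '' (↑s : Set ι)) x) →
      φ s ⊆ E ∧
      ((openCluster (ends '' (↑s : Set ι)) x ∪ openCluster (ends '' (↑(E \ s) : Set ι)) x ⊆ openCluster (ends '' (↑(φ s) : Set ι)) x ∧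
        openCluster (ends '' (↑(E \ φ s) : Set ι)) x ⊆ openCluster (ends '' (↑s : Set ι)) x ∩ openCluster (ends '' (↑(E \ s) : Set ι)) x) ∨
       (openCluster (ends '' (↑s : Set ι)) x ∪ openCluster (ends '' (↑(E \ s) : Set ι)) x ⊆ openCluster (ends '' (↑(E \ φ s) : Set ι)) x ∧
        openCluster (ends '' (↑(φ s) : Set ι)) x ⊆ openCluster (ends '' (↑s : Set ι)) x ∩ openCluster (ends '' (↑(E \ s) : Set ι)) x)))
    (hinj : ∀ s s', s ⊆ E → s' ⊆ E →
      ¬ (openCluster (ends '' (↑s : Set ι)) x ⊆ openCluster (ends '' (↑(E \ s) : Set ι)) x) →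
      ¬ (openCluster (ends '' (↑(E \ s) : Set ι)) x ⊆ openCluster (ends '' (↑s : Set ι)) x) →
      ¬ (openCluster (ends '' (↑s' : Set ι)) x ⊆ openCluster (ends '' (↑(E \ s') : Set ι)) x) →
      ¬ (openCluster (ends '' (↑(E \ s') : Set ι)) x ⊆ openCluster (ends '' (↑s' : Set ι)) x) →
      φ s = φ s' → s = s')
    (D : Set V → Prop) (hD : ∀ Z Z' : Set V, D Z → Z' ⊆ Z → D Z')
    (f g : Set V → ℝ) (hf : Monotone f) (hg : Monotone g) :
    0 ≤ ∑ s ∈ E.powerset.filter (fun s : Finset ι => D (openCluster (ends '' (↑s : Set ι)) x ∩ openCluster (ends '' (↑(E \ s) : Set ι)) x)),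
      (f (openCluster (ends '' (↑s : Set ι)) x) - f (openCluster (ends '' (↑(E \ s) : Set ι)) x)) *
        (g (openCluster (ends '' (↑s : Set ι)) x) - g (openCluster (ends '' (↑(E \ s) : Set ι)) x)) := by
  set K : Finset ι → Set V := fun s => openCluster (ends '' (↑s : Set ι)) x with hK
  refine tsum_nonneg_of_dominating_injection ends E x _ φ ?_ ?_ f g hf hg
  · intro s hs h1 h2
    obtain ⟨hsE, hDs⟩ := Finset.mem_filter.mp hs
    have hsE' := Finset.mem_powerset.mp hsE
    obtain ⟨hφE, hd⟩ := hdom s hsE' h1 h2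
    refine ⟨Finset.mem_filter.mpr ⟨Finset.mem_powerset.mpr hφE, hD _ _ hDs ?_⟩, hd⟩
    -- the core of the partner lies in the core of `s`
    change K (φ s) ∩ K (E \ φ s) ⊆ K s ∩ K (E \ s)
    rcases hd with ⟨_, hB⟩ | ⟨_, hKφ⟩
    · exact fun v hv => hB hv.2
    · exact fun v hv => hKφ hv.1
  · intro s hs s' hs' h1 h2 h1' h2' heq
    exact hinj s s' (Finset.mem_powerset.mp (Finset.mem_filter.mp hs).1) (Finset.mem_powerset.mp (Finset.mem_filter.mp hs').1) h1 h2 h1' h2' heq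

open Classical in
/-- **Uniform domination ⇒ NC* for every target set.**  Under the hypotheses of `coreAntitone_tsum_nonneg_of_uniform_domination`, for every `W` and all monotone `f, g`:
`0 ≤ Σ_{s ⊆ E : ∀ w ∈ W, ¬(w ∈ C_x s ∧ w ∈ C_x(E∖s))} (f (C_x s) − f (C_x(E∖s)))(g (C_x s) − g (C_x(E∖s)))`.
[cite: KozmaNitzan2024, Questions 8–9 (§5.5 p. 36) (context)] -/
theorem ncStar_of_uniform_domination (ends : ι → Sym2 V) (E : Finset ι) (x : V) (φ : Finset ι → Finset ι)
    (hdom : ∀ s, s ⊆ E → ¬ (openCluster (ends '' (↑s : Set ι)) x ⊆ openCluster (ends '' (↑(E \ s) : Set ι)) x) →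
      ¬ (openCluster (ends '' (↑(E \ s) : Set ι)) x ⊆ openCluster (ends '' (↑s : Set ι)) x) →
      φ s ⊆ E ∧
      ((openCluster (ends '' (↑s : Set ι)) x ∪ openCluster (ends '' (↑(E \ s) : Set ι)) x ⊆ openCluster (ends '' (↑(φ s) : Set ι)) x ∧
        openCluster (ends '' (↑(E \ φ s) : Set ι)) x ⊆ openCluster (ends '' (↑s : Set ι)) x ∩ openCluster (ends '' (↑(E \ s) : Set ι)) x) ∨
       (openCluster (ends '' (↑s : Set ι)) x ∪ openCluster (ends '' (↑(E \ s) : Set ι)) x ⊆ openCluster (ends '' (↑(E \ φ s) : Set ι)) x ∧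
        openCluster (ends '' (↑(φ s) : Set ι)) x ⊆ openCluster (ends '' (↑s : Set ι)) x ∩ openCluster (ends '' (↑(E \ s) : Set ι)) x)))
    (hinj : ∀ s s', s ⊆ E → s' ⊆ E →
      ¬ (openCluster (ends '' (↑s : Set ι)) x ⊆ openCluster (ends '' (↑(E \ s) : Set ι)) x) →
      ¬ (openCluster (ends '' (↑(E \ s) : Set ι)) x ⊆ openCluster (ends '' (↑s : Set ι)) x) →
      ¬ (openCluster (ends '' (↑s' : Set ι)) x ⊆ openCluster (ends '' (↑(E \ s') : Set ι)) x) →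
      ¬ (openCluster (ends '' (↑(E \ s') : Set ι)) x ⊆ openCluster (ends '' (↑s' : Set ι)) x) →
      φ s = φ s' → s = s')
    (W : Set V) (f g : Set V → ℝ) (hf : Monotone f) (hg : Monotone g) :
    0 ≤ ∑ s ∈ E.powerset.filter (fun s : Finset ι =>
          ∀ w ∈ W, ¬ (w ∈ openCluster (ends '' (↑s : Set ι)) x ∧ w ∈ openCluster (ends '' (↑(E \ s) : Set ι)) x)),
      (f (openCluster (ends '' (↑s : Set ι)) x) - f (openCluster (ends '' (↑(E \ s) : Set ι)) x)) *
        (g (openCluster (ends '' (↑s : Set ι)) x) - g (openCluster (ends '' (↑(E \ s) : Set ι)) x)) := by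
  have hcongr : ∀ s ∈ E.powerset,
      (∀ w ∈ W, ¬ (w ∈ openCluster (ends '' (↑s : Set ι)) x ∧ w ∈ openCluster (ends '' (↑(E \ s) : Set ι)) x)) ↔
      (∀ w ∈ W, w ∉ openCluster (ends '' (↑s : Set ι)) x ∩ openCluster (ends '' (↑(E \ s) : Set ι)) x) := by
    intro s _; exact Iff.rfl
  rw [Finset.filter_congr hcongr]
  exact coreAntitone_tsum_nonneg_of_uniform_domination ends E x φ hdom hinj (fun Z => ∀ w ∈ W, w ∉ Z)
    (fun Z Z' h hZ w hw hwZ => h w hw (hZ hwZ)) f g hf hg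

end Coefficientwise

end Summit.CriticalPhenomena.PercolationContinuityZ3.Theorems
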